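import Summits.CriticalPhenomena.PercolationContinuityZ3.Theorems.PercNearOneGluingNoHeavyQuantFlowPieces
import Summits.CriticalPhenomena.PercolationContinuityZ3.Theorems.PercNearOneGluingNoHeavyQuantDECAtTMixtures
import Summits.CriticalPhenomena.PercolationContinuityZ3.Theorems.PercNearOneGluingNoHeavyQuantLawDecFlowsDecomposition
import Summits.CriticalPhenomena.PercolationContinuityZ3.Theorems.PercNearOneGluingNoHeavyQuantSGCLightCellsBoth
import Summits.CriticalPhenomena.PercolationContinuityZ3.Theorems.PercNearOneGluingNoHeavyQuantRootReductionMeanLeOne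
import HarnessLib

/-!
# QUANT lane R8, T-DEC, ROUTE 2: two law-agnostic admissibility criteria — a HEAVY TOP ATOM carries every layer, and a law with NO
# nonzero low atom is admissible — and the gated three-atom laws they settle (the comonotone Fréchet law of two heavy pairs, …)

builds on p205010 (kernel theorem, internal audit signed; external expert review pending)

Support file (`--supports stmt-CriticalPhenomena-4575`), QUANT lane, seat prim-quant-arm-2 (gen 37), rung R8 of
`run/shared/lean/prim/quant/LADDER.md`; first kernel piece of the lead g35 ruling "arm-2 owns `AD3FrechetCell`" (INBOX l.1198): the
Fréchet laws `frCo`, `frCt` of two pair components (lead g35, `…QuantAD3Frechet`) are explicit three-atom laws, and for two HEAVY pairs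
the comonotone law and the small countermonotone law (`α + β ≤ 1`) have a heavy top atom.  Theorems only, standard axioms, no sorries.

* **`LawDec.decAt_all_of_heavyTop`** — a law `μ` on `{0..M}` supported on `{0..d}` (`d ≤ M`), floor `0 < y < 1`, with `y ≤ μ d` and
  `y·d ≤ mean`, is `DECAt y j′ M` at EVERY layer `j′ < M`: below `d` the giant `d` alone carries all lows at the floor gate
  (`flowAtT_of_giants`: `u·(1 − μ d) ≤ μ d ⟺ y ≤ μ d`), at and above `d` Theorem A (`decAt_of_top_le`, `decAtT_mono_top`).
* **`LawDec.decAt_all_of_noLow`** — a law on `{0..M}` with `y·M ≤ mean` none of whose charged NONZERO atoms is low (`mean ≤ 2h`) is DEC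
  at every layer (`flowAtT_of_moment`: the only low is `0`).
* `LawDec.triple_gate_decAt_of_heavyTop` — the `q`-gate of a three-atom law `TR[s₁, s₂, s₃]` whose largest atom `s₃` carries `q·p₃ ≥ y`,
  with `y·M ≤ q·T`, is DEC at every layer `j′ < M`.
* `LawDec.TR_swap12`, `TR_swap23` — reordering the atoms of a `TR` law.

[this work]; flow normal form / criterion E / Theorem A / law bookkeeping: this lane (typer g22–g31, lead g21, census-2 g50).  The gluing
rows served [cite: KozmaNitzan2024, Conjecture 3 (p. 15)]; product measure [cite: Grimmett1999, §1.3 p. 10].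
-/

noncomputable section

namespace Summit.CriticalPhenomena.PercolationContinuityZ3.Theorems

namespace Quant

open Finset

/-- three-atom law notation `TR[s₁, s₂, s₃, p₁, p₂, p₃, h] = p₁·[h = s₁] + p₂·[h = s₂] + p₃·[h = s₃]`. -/
local notation3 "TR[" s₁ ", " s₂ ", " s₃ ", " p₁ ", " p₂ ", " p₃ ", " h "]" =>
  (p₁ : ℝ) * (if (h : ℕ) = (s₁ : ℕ) then (1 : ℝ) else 0) + (p₂ : ℝ) * (if (h : ℕ) = (s₂ : ℕ) then (1 : ℝ) else 0)
    + (p₃ : ℝ) * (if (h : ℕ) = (s₃ : ℕ) then (1 : ℝ) else 0)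

namespace LawDec

/-! ### A heavy top atom carries every layer -/

/-- **A HEAVY TOP ATOM CARRIES EVERY LAYER.**  `μ ≥ 0` a law on `{0..M}` of mass `1` supported on `{0..d}` (`d ≤ M`), floor
`0 < y < 1`, `y ≤ μ d`, `y·d ≤ mean`: then `μ` is `DECAt y j′ M` for every `j′ < M`. [this work] -/
theorem decAt_all_of_heavyTop (y : ℝ) (M d : ℕ) (μ : ℕ → ℝ) (hy0 : 0 < y) (hy1 : y < 1) (hμ0 : ∀ h, 0 ≤ μ h)
    (hμd : ∀ h, d < h → μ h = 0) (hdM : d ≤ M) (hμ1 : ∑ h ∈ Finset.range (M + 1), μ h = 1) (hheavy : y ≤ μ d)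
    (hta : y * (d : ℝ) ≤ ∑ h ∈ Finset.range (M + 1), (h : ℝ) * μ h) :
    ∀ j', j' < M → DECAt y j' M μ := by
  intro j' hj'
  have hμM : ∀ h, M < h → μ h = 0 := fun h hh => hμd h (by omega)
  have h1y : 0 < 1 - y := by linarith
  by_cases hjd : j' < d
  · -- the giant `d` carries everything
    rw [decAt_iff_decAtT]
    refine decAtT_of_flowAtT y _ j' M μ hy0 hy1 hμM hμ1 (flowAtT_of_giants y _ j' M μ hy0 hy1 hμ0 ?_)
    set G : ℝ := ∑ h ∈ Finset.Ico (j' + 1) (M + 1), μ h with hG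
    have hsplit : (∑ h ∈ Finset.range (j' + 1), μ h) + G = 1 := by
      rw [hG, Finset.sum_range_add_sum_Ico μ (show j' + 1 ≤ M + 1 by omega), hμ1]
    have hdG : μ d ≤ G :=
      Finset.single_le_sum (f := μ) (fun h _ => hμ0 h) (Finset.mem_Ico.2 ⟨by omega, by omega⟩)
    have hlow : ∑ l ∈ Finset.range (j' + 1), (if 2 * (l : ℝ) < ∑ h ∈ Finset.range (M + 1), (h : ℝ) * μ h then μ l else 0)
        ≤ ∑ l ∈ Finset.range (j' + 1), μ l :=
      Finset.sum_le_sum fun l _ => by split_ifs; exacts [le_rfl, hμ0 l]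
    have key : y / (1 - y) * ∑ l ∈ Finset.range (j' + 1), μ l ≤ G := by
      rw [div_mul_eq_mul_div, div_le_iff₀ h1y]
      nlinarith
    exact le_trans (mul_le_mul_of_nonneg_left hlow (div_pos hy0 h1y).le) key
  · -- Theorem A with top `d`
    have hdj : d ≤ j' := not_lt.1 hjd
    have hμ1d : ∑ h ∈ Finset.range (d + 1), μ h = 1 := by
      rw [← RootDec.sum_range_eq_of_vanish μ d M hdM hμd]; exact hμ1
    have hmean : ∑ h ∈ Finset.range (M + 1), (h : ℝ) * μ h = ∑ h ∈ Finset.range (d + 1), (h : ℝ) * μ h :=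
      RootDec.sum_range_eq_of_vanish (fun h => (h : ℝ) * μ h) d M hdM (fun h hh => by rw [hμd h hh, mul_zero])
    have htop : ∀ h, 0 < μ h → y * (h : ℝ) ≤ ∑ k ∈ Finset.range (d + 1), (k : ℝ) * μ k := by
      intro h hh
      have hhd : h ≤ d := by
        by_contra hlt
        exact absurd (hμd h (not_le.1 hlt)) (ne_of_gt hh)
      rw [← hmean]
      have : y * (h : ℝ) ≤ y * (d : ℝ) := mul_le_mul_of_nonneg_left (by exact_mod_cast hhd) hy0.le
      linarith
    have hA := decAt_of_top_le d μ hμ0 hμd hμ1d y hy1 htop j' hdj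
    rw [decAt_iff_decAtT, ← hmean] at hA
    rw [decAt_iff_decAtT]
    exact decAtT_mono_top hA hdM

/-! ### No nonzero low atom -/

/-- **A LAW WITH NO NONZERO LOW ATOM IS DEC AT EVERY LAYER.**  `μ ≥ 0` on `{0..M}`, mass `1`, floor `0 < y < 1`, `y·M ≤ mean`, and
every charged atom `h ≥ 1` satisfies `mean ≤ 2h`: then `DECAt y j′ M μ` for all `j′ < M` (the first-moment criterion
`flowAtT_of_moment`, the only low being `0`).  Covers the lane's "zero-or-big" and "`2s₁ ≥ τ`" situations. [this work] -/
theorem decAt_all_of_noLow (y : ℝ) (M : ℕ) (μ : ℕ → ℝ) (hy0 : 0 < y) (hy1 : y < 1) (hμ0 : ∀ h, 0 ≤ μ h)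
    (hμM : ∀ h, M < h → μ h = 0) (hμ1 : ∑ h ∈ Finset.range (M + 1), μ h = 1)
    (hta : y * (M : ℝ) ≤ ∑ h ∈ Finset.range (M + 1), (h : ℝ) * μ h)
    (hbig : ∀ h, 1 ≤ h → 0 < μ h → ∑ k ∈ Finset.range (M + 1), (k : ℝ) * μ k ≤ 2 * (h : ℝ)) :
    ∀ j', j' < M → DECAt y j' M μ := by
  intro j' hj'
  set T : ℝ := ∑ h ∈ Finset.range (M + 1), (h : ℝ) * μ h with hT
  have hM1 : (1 : ℝ) ≤ M := by exact_mod_cast (show 1 ≤ M by omega)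
  have hT0 : 0 < T := by nlinarith
  rw [decAt_iff_decAtT]
  refine decAtT_of_flowAtT y T j' M μ hy0 hy1 hμM hμ1
    (flowAtT_of_moment y T j' M μ hy0 hy1 hT0 hμ0 (fun l hl1 hlj hlow => ?_) hta (by rw [hμ1, mul_one]))
  by_contra hne
  have hpos : 0 < μ l := lt_of_le_of_ne (hμ0 l) (Ne.symm hne)
  have := hbig l hl1 hpos
  linarith

/-! ### Gated three-atom laws with a heavy top -/

/-- reorder the first two atoms of a `TR` law. [folklore] -/
theorem TR_swap12 (s₁ s₂ s₃ : ℕ) (p₁ p₂ p₃ : ℝ) :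
    (fun h : ℕ => TR[s₁, s₂, s₃, p₁, p₂, p₃, h]) = fun h => TR[s₂, s₁, s₃, p₂, p₁, p₃, h] := by
  funext h; ring

/-- reorder the last two atoms of a `TR` law. [folklore] -/
theorem TR_swap23 (s₁ s₂ s₃ : ℕ) (p₁ p₂ p₃ : ℝ) :
    (fun h : ℕ => TR[s₁, s₂, s₃, p₁, p₂, p₃, h]) = fun h => TR[s₁, s₃, s₂, p₁, p₃, p₂, h] := by
  funext h; ring

/-- **THE GATE OF A THREE-ATOM LAW WITH A HEAVY TOP IS DEC AT EVERY LAYER.**  Atoms `s₁, s₂ ≤ s₃ ≤ M` (`0 < s₃`; coincidences allowed),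
masses `pᵢ ≥ 0` summing to `1`, mean `T`, gate `0 ≤ q ≤ 1`, floor `0 < y < 1`, `y ≤ q·p₃` (the top atom is heavy after gating) and
`y·M ≤ q·T`: then `gate_q TR[s₁,s₂,s₃]` is `DECAt y j′ M` for every `j′ < M`. [this work] -/
theorem triple_gate_decAt_of_heavyTop (y q T : ℝ) (M s₁ s₂ s₃ : ℕ) (p₁ p₂ p₃ : ℝ) (hy0 : 0 < y) (hy1 : y < 1)
    (hq0 : 0 ≤ q) (hq1 : q ≤ 1) (h13 : s₁ ≤ s₃) (h23 : s₂ ≤ s₃) (h3 : s₃ ≤ M) (h03 : 0 < s₃)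
    (hp₁ : 0 ≤ p₁) (hp₂ : 0 ≤ p₂) (hp₃ : 0 ≤ p₃) (hp : p₁ + p₂ + p₃ = 1)
    (hT : p₁ * (s₁ : ℝ) + p₂ * (s₂ : ℝ) + p₃ * (s₃ : ℝ) = T) (hheavy : y ≤ q * p₃) (hta : y * (M : ℝ) ≤ q * T) :
    ∀ j', j' < M → DECAt y j' M (gate (fun h => TR[s₁, s₂, s₃, p₁, p₂, p₃, h]) q) := by
  obtain ⟨t0, tM, t1, tmean⟩ := triple_laws' p₁ p₂ p₃ T M s₁ s₂ s₃ (h13.trans h3) (h23.trans h3) h3 hp₁ hp₂ hp₃ hp hT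
  obtain ⟨n0, -, n1⟩ := gate_laws M (fun h => TR[s₁, s₂, s₃, p₁, p₂, p₃, h]) q hq0 hq1 t0 tM t1
  have nmean : ∑ h ∈ Finset.range (M + 1), (h : ℝ) * gate (fun h => TR[s₁, s₂, s₃, p₁, p₂, p₃, h]) q h = q * T := by
    rw [sum_mul_gate, tmean]
  have nd : ∀ h, s₃ < h → gate (fun h => TR[s₁, s₂, s₃, p₁, p₂, p₃, h]) q h = 0 := by
    intro h hh
    simp only [gate]
    rw [if_neg (show h ≠ s₁ by omega), if_neg (show h ≠ s₂ by omega), if_neg (show h ≠ s₃ by omega),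
      if_neg (show h ≠ 0 by omega)]
    ring
  refine decAt_all_of_heavyTop y M s₃ _ hy0 hy1 n0 nd h3 n1 ?_ ?_
  · -- the top atom carries at least `q·p₃`
    show y ≤ q * TR[s₁, s₂, s₃, p₁, p₂, p₃, s₃] + (if s₃ = 0 then 1 - q else 0)
    rw [if_neg (show s₃ ≠ 0 by omega), add_zero, if_pos rfl, mul_one]
    have h1 : 0 ≤ p₁ * (if s₃ = s₁ then (1 : ℝ) else 0) := mul_nonneg hp₁ (by split_ifs <;> norm_num)
    have h2 : 0 ≤ p₂ * (if s₃ = s₂ then (1 : ℝ) else 0) := mul_nonneg hp₂ (by split_ifs <;> norm_num)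
    nlinarith
  · rw [nmean]
    have : y * (s₃ : ℝ) ≤ y * (M : ℝ) := mul_le_mul_of_nonneg_left (by exact_mod_cast h3) hy0.le
    linarith

end LawDec

end Quant

end Summit.CriticalPhenomena.PercolationContinuityZ3.Theorems
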